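import Mathlib
import HarnessLib
import Summits.NavierStokesRegularity.NavierStokesRegularity.Theorems.HalfSpaceWindowDoorCirculationCarryingRigidityEddyBarrier
import Summits.NavierStokesRegularity.NavierStokesRegularity.Theorems.HalfSpaceWindowDoorCirculationCarryingRigidityParabolicConfinement
import Summits.NavierStokesRegularity.NavierStokesRegularity.Theorems.HalfSpaceWindowDoorCirculationCarryingRigidityRotate

/-!
# Route `HalfSpaceWindowDoor`, crux `CirculationCarryingRigidity` (stmt-NavierStokesRegularity-25311) —
# line `eddy_covariance`, Steps 2+4: the SWEEPING LEMMA from the eddy bound, and W6 = `HemisphereLiouvilleE3` / the crux FROM THE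
# EDDY BOUND on record far circles, BY NAME

LEAD ns-hsw-p1 g10, `--supports stmt-NavierStokesRegularity-25311 --as helper`; card `Cruxes/…/Lines/eddy_covariance.md`.
From the barrier comparison `…EddyBarrier.circ_le_of_eddy_aux` (mean advection `v̄_rΓ_r + v̄_zΓ_z` absorbed as a drift; time-only
class, any `C`) the SWEEPING LEMMA `circ_le_sSup_of_eddy`: the circulations of the whole epoch `s ≤ s₁` are bounded, for ALL `r`, by the
supremum of the TUBE-BOUNDARY circulations `Γ(R₁√(−s'),z',s')`, `s' ≤ s₁` (`R₁ = 4(B+C) + R₀ + 1`; `sSup_le_of_eddy`, `circ_le_const_of_eddy`: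
finite plane flux `≤ 2πR₁C`).  This is exactly PARABOLIC CONFINEMENT in the sense of g9's kinematic core
`…ParabolicConfinement.inner_curl_e3_eq_zero_of_confined` (zooms + F3 + plane rigidity): hence

* `inner_curl_e3_eq_zero_of_eddyBound` — door class (time-only Type-I rate, ANY `C`) + `⟪curl v, e₃⟫ ≥ 0` + the EDDY BOUND
  `ℛ(r,z,t) ≤ (B/√(−t))·(∮_{S(r,z)} ω₃ dl + |∮_{S(r,z)} ω_r dl|)` merely at times `t ≤ σ₀` (one far-past epoch) and merely on RECORD
  far circles about ONE vertical axis (`r ≥ R₀√(−t)`, `Γ(r,z,t) > Γ(R₁√(−s'),z',s')` for all `s' ≤ t`, `z'`) ⇒ POLOIDAL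
  (`⟪curl v, e₃⟫ ≡ 0`).  Here `ℛ = ∮_{S(r,z)}[(v_z − v̄_z) ω_r − (v_r − v̄_r) ω₃] dl` is the fluctuation (EDDY) remainder of the
  circle law, `v̄_r, v̄_z` the circle means (AxisTwistDoor `remainder`, `meanR`, `meanZ`); the mean advection `v̄_rΓ_r + v̄_zΓ_z` is
  FREE (absorbed as a drift), and so is any multiple `≤ B/√(−t)` of the NET radial vorticity `|∮ω_r dl| = |Γ_z|`.
* `hemisphereLiouvilleE3_of_eddyBound` / `circulationCarryingRigidity_of_eddyBound` — BY-NAME reductions of the open research stub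
  W6 and of the crux (every direction, `stub_rotate`) to the eddy bound; `enemy_eddy_fails` — the census reading in enemy form:
  a circulation-carrying closed-hemisphere profile has, for all `B, R₀ ≥ 0` and every far-past epoch, a RECORD far circle on which
  `ℛ > (B/√(−t))(∮ω₃ dl + |∮ω_r dl|)`: since `−∮(v_r − v̄_r)ω₃ ≤ (2C/√(−t))∮ω₃ dl` always, the excess is the EDDY LIFT
  `∮(v_z − v̄_z)(ω_r − ω̄_r) dl` — the circle COVARIANCE of vertical velocity and radial vorticity — which must beat BOTH the vertical
  vorticity `∮ω₃ dl` AND the net radial vorticity `|∮ω_r dl|` on the circle by the factor `B/√(−t)`, for every `B` (see `…EddyStrata`).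
Compared with g9 (`…RecordLiouville` / `…RadialLift`: hypothesis on the full lift `∮ω_r v_z dl`): the mean vertical advection
`−v̄_z Γ_z` no longer counts against the profile — only genuinely non-axisymmetric, CORRELATED fluctuations do.
WHAT THIS IS NOT: not about NS regularity (Clay A); regularity criteria about HYPOTHETICAL blow-up profiles (KNSS ancient mild
solutions); the item stays OPEN at its research stub; no item is closed by this file.
-/

noncomputable section

-- the summit and its single sub-problem share the name (CONVENTIONS §1), as in every Theorems file
set_option linter.dupNamespace false

namespace Summit.NavierStokesRegularity.NavierStokesRegularity.Theorems.HalfSpaceWindowDoorCirculationCarryingRigidityEddyLiouville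

open MeasureTheory Set Function Filter Topology InnerProductSpace
open scoped RealInnerProductSpace InnerProductSpace
open Literature.Analysis Literature.Analysis.UnboundedOperators
open Literature.Analysis.FluidPDE hiding eR
open Summit.NavierStokesRegularity.NavierStokesRegularity.Theses.HalfSpaceWindowDoor (CirculationCarryingRigidity)
open Summit.NavierStokesRegularity.NavierStokesRegularity.Theorems.HalfSpaceWindowDoorCirculationCarryingRigidityDefs
  (InDoorClass SignE3 e3 HemisphereLiouvilleE3)
open Summit.NavierStokesRegularity.NavierStokesRegularity.Theorems.AxisTwistDoorAveragedConeLiouvilleDefs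
  (cylPt eR circ vortCirc radVortCirc circleTerm meanR meanZ remainder)
open Summit.NavierStokesRegularity.NavierStokesRegularity.Theorems.HalfSpaceWindowDoorCirculationCarryingRigidityConeFluxSubsolution
  (tube_bddAbove)
open Summit.NavierStokesRegularity.NavierStokesRegularity.Theorems.HalfSpaceWindowDoorCirculationCarryingRigidityEddyBarrier
  (circ_le_of_eddy_aux)
open Summit.NavierStokesRegularity.NavierStokesRegularity.Theorems.PoloidalWindowDoorPoloidalWindowRigidityClassSpaceTimeRates
  (exists_fderiv_rate_of_class')
open Summit.NavierStokesRegularity.NavierStokesRegularity.Theorems.HalfSpaceWindowDoorCirculationCarryingRigidityParabolicConfinement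
  (inner_curl_e3_eq_zero_of_confined)
open Summit.NavierStokesRegularity.NavierStokesRegularity.Theorems.HalfSpaceWindowDoorCirculationCarryingRigidityRotate (stub_rotate)

variable {C : ℝ} {v : ℝ → EuclideanSpace ℝ (Fin 3) → EuclideanSpace ℝ (Fin 3)}

/-! ### Step 2: the sweeping lemma from the eddy bound -/

/-- **THE SWEEPING LEMMA, eddy form**: `Γ(r,z,s) ≤ sup { Γ(R₁√(−s'), z', s') : s' ≤ s₁ }` for all `r ≥ 0`, `s ≤ s₁ < 0`,
`R₁ = 4(B+C) + R₀ + 1`, from the EDDY bound `ℛ ≤ (B/√(−t))(∮ω₃ dl + |∮ω_r dl|)` on RECORD far circles about the axis at times `≤ s₁`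
only (the mean advection `v̄_r Γ_r + v̄_z Γ_z` is free). -/
theorem circ_le_sSup_of_eddy (hv : InDoorClass C v) (hsign : SignE3 v) {B : ℝ} (hB0 : 0 ≤ B)
    {R₀ : ℝ} (hR₀ : 0 ≤ R₀) {s₁ : ℝ} (hs₁ : s₁ < 0)
    (hed : ∀ t : ℝ, t ≤ s₁ → ∀ r : ℝ, R₀ * Real.sqrt (-t) ≤ r → ∀ z : ℝ,
      (∀ s' : ℝ, s' ≤ t → ∀ z' : ℝ, circ v ((4 * (B + C) + R₀ + 1) * Real.sqrt (-s')) z' s' < circ v r z t) →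
      remainder v r z t ≤ B / Real.sqrt (-t) * (vortCirc v r z t + |radVortCirc v r z t|))
    {s : ℝ} (hs : s ≤ s₁) {r : ℝ} (hr : 0 ≤ r) (z : ℝ) :
    circ v r z s ≤ sSup {m : ℝ | ∃ s' : ℝ, s' ≤ s₁ ∧ ∃ z' : ℝ, m = circ v ((4 * (B + C) + R₀ + 1) * Real.sqrt (-s')) z' s'} := by
  obtain ⟨K₁, hK₁0, hK₁⟩ := exists_fderiv_rate_of_class' hv.1 hv.2.1 hv.2.2.1
  set μ := sSup {m : ℝ | ∃ s' : ℝ, s' ≤ s₁ ∧ ∃ z' : ℝ, m = circ v ((4 * (B + C) + R₀ + 1) * Real.sqrt (-s')) z' s'}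
  have hs0 : s < 0 := lt_of_le_of_lt hs hs₁
  have hsqs : 0 < Real.sqrt (-s) := Real.sqrt_pos.2 (neg_pos.2 hs0)
  refine le_of_forall_pos_le_add fun δ hδ => ?_
  set A : ℝ := Real.pi * (4 * K₁ + 1) with hA
  have hApos : 0 < A := by positivity
  set L : ℝ := A * r ^ 2 / (Real.sqrt (-s) * δ) with hL
  have hL0 : 0 ≤ L := by positivity
  set s₀ : ℝ := s - 1 - L ^ 2 with hs₀def
  have hs₀s : s₀ < s := by rw [hs₀def]; nlinarith [sq_nonneg L]
  have hs₀₁ : s₀ < s₁ := lt_of_lt_of_le hs₀s hs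
  have hsq₀ : L ≤ Real.sqrt (-s₀) := by
    rw [show L = Real.sqrt (L ^ 2) from (Real.sqrt_sq hL0).symm]
    exact Real.sqrt_le_sqrt (by rw [hs₀def]; linarith)
  have hsq₀pos : 0 < Real.sqrt (-s₀) := Real.sqrt_pos.2 (by linarith)
  have h := circ_le_of_eddy_aux hv hsign hB0 hR₀ hK₁0 hK₁ hs₀₁ hs₁ hed s ⟨hs₀s.le, hs⟩ r hr z
  have hbound : Real.pi * (4 * K₁ + 1) * r ^ 2 / (Real.sqrt (-s) * Real.sqrt (-s₀)) ≤ δ := by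
    rw [← hA, div_le_iff₀ (by positivity)]
    have h1 : A * r ^ 2 = L * (Real.sqrt (-s) * δ) := by rw [hL]; field_simp
    rw [h1]
    have := mul_le_mul_of_nonneg_left hsq₀ (by positivity : 0 ≤ Real.sqrt (-s) * δ)
    nlinarith [this]
  linarith

/-- **The supremum over tube-boundary discs is at most `2πR₁C`** (`R₁ = 4(B+C) + R₀ + 1`; class bound only). -/
theorem sSup_le_of_eddy (hv : InDoorClass C v) {B : ℝ} (hB0 : 0 ≤ B) {R₀ : ℝ} (hR₀ : 0 ≤ R₀) {s₁ : ℝ} (hs₁ : s₁ < 0) :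
    sSup {m : ℝ | ∃ s' : ℝ, s' ≤ s₁ ∧ ∃ z' : ℝ, m = circ v ((4 * (B + C) + R₀ + 1) * Real.sqrt (-s')) z' s'} ≤
      2 * Real.pi * ((4 * (B + C) + R₀ + 1) * C) := by
  have hC := HalfSpaceWindowDoorCirculationCarryingRigidityConeFluxSubsolution.typeI_const_nonneg hv
  have hR₁ : 0 ≤ 4 * (B + C) + R₀ + 1 := by positivity
  obtain ⟨-, hle⟩ := tube_bddAbove hv hR₁ hs₁
  refine csSup_le ⟨_, s₁, le_rfl, 0, rfl⟩ fun m hm => ?_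
  have := hle m hm
  linarith

/-- **FINITE PLANE FLUX** from the eddy bound on record circles up to time `s`: `Γ(r,z,s) ≤ 2πR₁C` for ALL `r`. -/
theorem circ_le_const_of_eddy (hv : InDoorClass C v) (hsign : SignE3 v) {B : ℝ} (hB0 : 0 ≤ B)
    {R₀ : ℝ} (hR₀ : 0 ≤ R₀) {s : ℝ} (hs : s < 0)
    (hed : ∀ t : ℝ, t ≤ s → ∀ r : ℝ, R₀ * Real.sqrt (-t) ≤ r → ∀ z : ℝ,
      (∀ s' : ℝ, s' ≤ t → ∀ z' : ℝ, circ v ((4 * (B + C) + R₀ + 1) * Real.sqrt (-s')) z' s' < circ v r z t) →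
      remainder v r z t ≤ B / Real.sqrt (-t) * (vortCirc v r z t + |radVortCirc v r z t|))
    {r : ℝ} (hr : 0 ≤ r) (z : ℝ) :
    circ v r z s ≤ 2 * Real.pi * ((4 * (B + C) + R₀ + 1) * C) :=
  (circ_le_sSup_of_eddy hv hsign hB0 hR₀ hs hed le_rfl hr z).trans (sSup_le_of_eddy hv hB0 hR₀ hs)

/-! ### Step 4: W6 and the crux from the eddy bound -/

/-- **W6 ⟸ THE EDDY BOUND ON RECORD FAR CIRCLES (time-only class, any `C`).**  Door class + `⟪curl v, e₃⟫ ≥ 0`; fix `B, R₀ ≥ 0`,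
`R₁ = 4(B+C) + R₀ + 1` and an epoch `σ₀ < 0`; if the eddy remainder obeys `ℛ(r,z,t) ≤ (B/√(−t))(∮_{S(r,z)}ω₃ dl + |∮_{S(r,z)}ω_r dl|)`
for `t ≤ σ₀` on the record far circles about the `e₃`-axis, then `⟪curl v, e₃⟫ ≡ 0` on the whole slab.  Proof: the eddy sweeping lemma
at `s₁ = σ₀` is parabolic confinement with `S₀ = sup{Γ(R₁√(−s'),z',s') : s' ≤ σ₀}`; apply `inner_curl_e3_eq_zero_of_confined`. -/
theorem inner_curl_e3_eq_zero_of_eddyBound (hv : InDoorClass C v) (hsign : SignE3 v) {B : ℝ} (hB : 0 ≤ B)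
    {R₀ : ℝ} (hR₀ : 0 ≤ R₀) {σ₀ : ℝ} (hσ₀ : σ₀ < 0)
    (hed : ∀ t : ℝ, t ≤ σ₀ → ∀ r : ℝ, R₀ * Real.sqrt (-t) ≤ r → ∀ z : ℝ,
      (∀ s' : ℝ, s' ≤ t → ∀ z' : ℝ, circ v ((4 * (B + C) + R₀ + 1) * Real.sqrt (-s')) z' s' < circ v r z t) →
      remainder v r z t ≤ B / Real.sqrt (-t) * (vortCirc v r z t + |radVortCirc v r z t|)) :
    ∀ s < 0, ∀ y, ⟪curl (v s) y, e3⟫ = 0 := by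
  have hC : 0 ≤ C := HalfSpaceWindowDoorCirculationCarryingRigidityConeFluxSubsolution.typeI_const_nonneg hv
  set R₁ : ℝ := 4 * (B + C) + R₀ + 1 with hR₁
  have hR₁0 : 0 ≤ R₁ := by positivity
  set S : Set ℝ := {m : ℝ | ∃ s' : ℝ, s' ≤ σ₀ ∧ ∃ z' : ℝ, m = circ v (R₁ * Real.sqrt (-s')) z' s'} with hS
  set S₀ : ℝ := sSup S with hS₀
  obtain ⟨hSbdd, -⟩ := tube_bddAbove hv hR₁0 hσ₀
  have hSne : S.Nonempty := ⟨_, σ₀, le_rfl, 0, rfl⟩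
  refine inner_curl_e3_eq_zero_of_confined hv hsign hR₁0 hσ₀ (S₀ := S₀) ?_ ?_
  · intro s hs r hr z
    exact circ_le_sSup_of_eddy hv hsign hB hR₀ hσ₀ hed hs hr z
  · intro ε hε
    have hlt : S₀ - ε < S₀ := by linarith
    obtain ⟨m, ⟨s', hs', z', rfl⟩, hm⟩ := exists_lt_of_lt_csSup hSne hlt
    exact ⟨s', hs', z', hm⟩

/-- **ENEMY FORM (census reading).**  A circulation-carrying closed-hemisphere door-class profile violates the eddy bound: for all
`B, R₀ ≥ 0` and every epoch `σ₀ < 0` there are a time `t ≤ σ₀` and a RECORD far circle `S(r,z)` (`r ≥ R₀√(−t)`, carrying more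
circulation than every tube-boundary disc `D(R₁√(−s'),z')`, `s' ≤ t`) with `ℛ(r,z,t) > (B/√(−t))(∮ω₃ dl + |∮ω_r dl|)`. -/
theorem enemy_eddy_fails (hv : InDoorClass C v) (hsign : SignE3 v) (hpos : ∃ σ < 0, ∃ y, 0 < ⟪curl (v σ) y, e3⟫)
    {B : ℝ} (hB : 0 ≤ B) {R₀ : ℝ} (hR₀ : 0 ≤ R₀) {σ₀ : ℝ} (hσ₀ : σ₀ < 0) :
    ∃ t : ℝ, t ≤ σ₀ ∧ ∃ r : ℝ, R₀ * Real.sqrt (-t) ≤ r ∧ ∃ z : ℝ,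
      (∀ s' : ℝ, s' ≤ t → ∀ z' : ℝ, circ v ((4 * (B + C) + R₀ + 1) * Real.sqrt (-s')) z' s' < circ v r z t) ∧
      B / Real.sqrt (-t) * (vortCirc v r z t + |radVortCirc v r z t|) < remainder v r z t := by
  by_contra h
  push Not at h
  obtain ⟨σ, hσ, y, hy⟩ := hpos
  have h0 := inner_curl_e3_eq_zero_of_eddyBound hv hsign hB hR₀ hσ₀
    (fun t ht r hr z hrec => h t ht r hr z hrec) σ hσ y
  exact hy.ne' h0

/-- **Crux format.**  In the situation of the crux specialised to `e = e₃` (closed hemisphere, circulation-carrying), the eddy bound on the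
record circles of one far-past epoch is contradictory — in particular the apex is not backward-singular. -/
theorem not_isBackwardSingularPoint_of_eddyBound (hv : InDoorClass C v) (hsign : SignE3 v)
    (hpos : ∃ σ < 0, ∃ y, 0 < ⟪curl (v σ) y, e3⟫) {B : ℝ} (hB : 0 ≤ B) {R₀ : ℝ} (hR₀ : 0 ≤ R₀) {σ₀ : ℝ} (hσ₀ : σ₀ < 0)
    (hed : ∀ t : ℝ, t ≤ σ₀ → ∀ r : ℝ, R₀ * Real.sqrt (-t) ≤ r → ∀ z : ℝ,
      (∀ s' : ℝ, s' ≤ t → ∀ z' : ℝ, circ v ((4 * (B + C) + R₀ + 1) * Real.sqrt (-s')) z' s' < circ v r z t) →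
      remainder v r z t ≤ B / Real.sqrt (-t) * (vortCirc v r z t + |radVortCirc v r z t|)) :
    ¬ IsBackwardSingularPoint v 0 := by
  intro _
  obtain ⟨t, ht, r, hr, z, hrec, hlt⟩ := enemy_eddy_fails hv hsign hpos hB hR₀ hσ₀
  exact (not_lt.2 (hed t ht r hr z hrec)) hlt

/-- **BY-NAME REDUCTION of the open stub W6.**  If every closed-hemisphere profile of the door class obeys, for SOME `B, R₀ ≥ 0` and SOME
epoch `σ₀ < 0`, the eddy bound on the record far circles about the `e₃`-axis at the times `≤ σ₀`, then `HemisphereLiouvilleE3` holds. -/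
theorem hemisphereLiouvilleE3_of_eddyBound
    (H : ∀ (C : ℝ) (v : ℝ → EuclideanSpace ℝ (Fin 3) → EuclideanSpace ℝ (Fin 3)), InDoorClass C v → SignE3 v →
      ∃ B : ℝ, 0 ≤ B ∧ ∃ R₀ : ℝ, 0 ≤ R₀ ∧ ∃ σ₀ : ℝ, σ₀ < 0 ∧
        ∀ t : ℝ, t ≤ σ₀ → ∀ r : ℝ, R₀ * Real.sqrt (-t) ≤ r → ∀ z : ℝ,
          (∀ s' : ℝ, s' ≤ t → ∀ z' : ℝ, circ v ((4 * (B + C) + R₀ + 1) * Real.sqrt (-s')) z' s' < circ v r z t) →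
          remainder v r z t ≤ B / Real.sqrt (-t) * (vortCirc v r z t + |radVortCirc v r z t|)) :
    HemisphereLiouvilleE3 := by
  intro C v hrate hcont hmild hdiv hnn
  have hv : InDoorClass C v := ⟨hrate, hcont, hmild, hdiv⟩
  obtain ⟨B, hB, R₀, hR₀, σ₀, hσ₀, hed⟩ := H C v hv hnn
  exact inner_curl_e3_eq_zero_of_eddyBound hv hnn hB hR₀ hσ₀ hed

/-- **The CRUX from the eddy bound** (every direction `e ≠ 0`: rotation covariance `stub_rotate` ∘ `hemisphereLiouvilleE3_of_eddyBound`). -/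
theorem circulationCarryingRigidity_of_eddyBound
    (H : ∀ (C : ℝ) (v : ℝ → EuclideanSpace ℝ (Fin 3) → EuclideanSpace ℝ (Fin 3)), InDoorClass C v → SignE3 v →
      ∃ B : ℝ, 0 ≤ B ∧ ∃ R₀ : ℝ, 0 ≤ R₀ ∧ ∃ σ₀ : ℝ, σ₀ < 0 ∧
        ∀ t : ℝ, t ≤ σ₀ → ∀ r : ℝ, R₀ * Real.sqrt (-t) ≤ r → ∀ z : ℝ,
          (∀ s' : ℝ, s' ≤ t → ∀ z' : ℝ, circ v ((4 * (B + C) + R₀ + 1) * Real.sqrt (-s')) z' s' < circ v r z t) →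
          remainder v r z t ≤ B / Real.sqrt (-t) * (vortCirc v r z t + |radVortCirc v r z t|)) :
    CirculationCarryingRigidity :=
  stub_rotate (hemisphereLiouvilleE3_of_eddyBound H)

end Summit.NavierStokesRegularity.NavierStokesRegularity.Theorems.HalfSpaceWindowDoorCirculationCarryingRigidityEddyLiouville

end
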